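import Summits.ValiantsHypothesis.ValiantsHypothesis.Theorems.KPlusLogSqLawTropicalBMarkedEdgeCoreSixCase1
import Summits.ValiantsHypothesis.ValiantsHypothesis.Theorems.KPlusLogSqLawTropicalBMarkedEdgeCoreSixCase2
import Summits.ValiantsHypothesis.ValiantsHypothesis.Theorems.KPlusLogSqLawTropicalBMarkedEdgeCoreSixCase3
import Summits.ValiantsHypothesis.ValiantsHypothesis.Theorems.KPlusLogSqLawTropicalBMarkedEdgeCoreSixCase4
import Summits.ValiantsHypothesis.ValiantsHypothesis.Theorems.KPlusLogSqLawTropicalBMarkedEdgeCoreSixCase5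
import Summits.ValiantsHypothesis.ValiantsHypothesis.Theorems.KPlusLogSqLawTropicalBMarkedEdgeCoreSixCase6
import Summits.ValiantsHypothesis.ValiantsHypothesis.Theorems.KPlusLogSqLawTropicalBMarkedEdgeCoreSixCase7
import Summits.ValiantsHypothesis.ValiantsHypothesis.Theorems.KPlusLogSqLawTropicalBMarkedEdgeCoreSixCase8
import Summits.ValiantsHypothesis.ValiantsHypothesis.Theorems.KPlusLogSqLawTropicalBMarkedEdgeCoreSixCase9
import Summits.ValiantsHypothesis.ValiantsHypothesis.Theorems.KPlusLogSqLawTropicalBMarkedEdgeCoreSixCase10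
import Summits.ValiantsHypothesis.ValiantsHypothesis.Theorems.KPlusLogSqLawTropicalBMarkedEdgeCoreSixCase11

/-!
# Route «KPlusLogSqLaw», crux `TropicalB` (stmt-ValiantsHypothesis-19771) — MARKED-EDGE sector:
# THE NESTED-TRIANGLE CORE {1,2},{1,3},{2,3},{0,4} IS NOT REALISABLE ON SIX NODES (kernel version of the located-exact m = 6 exclusion)

HONEST FRAMING.  Helper file (cell `pub-symmetroid`, seat val-sym-trop-p4 (g17), 2026-08-28; `--supports stmt-ValiantsHypothesis-19771 --as
helper`).  Final assembly of the kernel version of this seat's located-exact result (memo LAYER2-CORE-g17.md §2b, tool exp/lpc.c; independent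
certificate regeneration work/core6/gen/dfs6.py): in the abstract marked-edge setting of the four-bit chain on `V = Fin 6` (marked nodes 0..4 with
loop slopes 1,2,4,8,16, node 5 auxiliary, arbitrary presence `ok` and weights `w`) NO four covers with fixed-point patterns {1,2}, {1,3}, {2,3}, {0,4}
are simultaneously unique maximisers (at any four integer parameters).  Proof: slopes 6 < 10 < 12 < 17 order the parameters (`theta_lt_of_isMax`);
`cases_Z` splits on the eleven covers of pattern {0,4}; each case is a landed theorem `caseZ0 … caseZ10` (case files 1–11), whose leaves are the
459 landed Karamata certificate lemmas (certificate files 1–14) — 861 leaves in all, each an instance of `factors_eq_fin` (p660322).  This is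
the trop-p5 g18 «nested-triangle law» / this seat's «layer-2 core» at m = 6 ONLY: for m = 7, 8 the exclusion is located-exact (same tool,
22 372 / 2 104 158 certificates) and for m ≥ 9 it is open.  Nothing here concerns `TropicalB` in its window, `WeakLifting`, the doors,
`MatrixDescartes` (stmt-ValiantsHypothesis-18050) or VP ≠ VNP.
-/

set_option linter.dupNamespace false
set_option autoImplicit false

namespace Summit.ValiantsHypothesis.ValiantsHypothesis.Theorems.KPlusLogSqLaw
namespace MarkedEdge
namespace CoreSix

open Finset

/-- **THE NESTED-TRIANGLE CORE ON SIX NODES (kernel).**  In the marked-edge setting on `Fin 6` (loop slopes `2^i` at the marked nodes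
`i < 5`, slope `0` on every other arc; arbitrary presence predicate and weights), there are no four covers, each the unique maximiser of the
score at its own integer parameter, whose marked fixed points are exactly {1,2}, {1,3}, {2,3} and {0,4} respectively.  Equivalently: no
marked-edge design on six nodes has the four slopes 6, 10, 12, 17 as strict vertices of its upper hull. [this seat's theorem; 861 machine-
generated certificate leaves, all closed by `factors_eq_fin`] -/
theorem nestedTriangle_not_realisable_six (ok : Fin 6 → Fin 6 → Prop) (w g : Fin 6 → Fin 6 → ℤ)
    (hg : ∀ i j : Fin 6, g i j = if i = j ∧ (i : ℕ) < 5 then (2 : ℤ) ^ (i : ℕ) else 0)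
    {θB θC θE θZ : ℤ} {σB σC σE σZ : Equiv.Perm (Fin 6)}
    (hB : (∀ i, ok i (σB i)) ∧ ∀ τ : Equiv.Perm (Fin 6), τ ≠ σB → (∀ i, ok i (τ i)) →
      ∑ i, (w i (τ i) + θB * g i (τ i)) < ∑ i, (w i (σB i) + θB * g i (σB i)))
    (hC : (∀ i, ok i (σC i)) ∧ ∀ τ : Equiv.Perm (Fin 6), τ ≠ σC → (∀ i, ok i (τ i)) →
      ∑ i, (w i (τ i) + θC * g i (τ i)) < ∑ i, (w i (σC i) + θC * g i (σC i)))
    (hE : (∀ i, ok i (σE i)) ∧ ∀ τ : Equiv.Perm (Fin 6), τ ≠ σE → (∀ i, ok i (τ i)) →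
      ∑ i, (w i (τ i) + θE * g i (τ i)) < ∑ i, (w i (σE i) + θE * g i (σE i)))
    (hZ : (∀ i, ok i (σZ i)) ∧ ∀ τ : Equiv.Perm (Fin 6), τ ≠ σZ → (∀ i, ok i (τ i)) →
      ∑ i, (w i (τ i) + θZ * g i (τ i)) < ∑ i, (w i (σZ i) + θZ * g i (σZ i)))
    (hB1 : σB 1 = 1) (hB2 : σB 2 = 2) (hB0 : σB 0 ≠ 0) (hB3 : σB 3 ≠ 3) (hB4 : σB 4 ≠ 4)
    (hC1 : σC 1 = 1) (hC3 : σC 3 = 3) (hC0 : σC 0 ≠ 0) (hC2 : σC 2 ≠ 2) (hC4 : σC 4 ≠ 4)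
    (hE2 : σE 2 = 2) (hE3 : σE 3 = 3) (hE0 : σE 0 ≠ 0) (hE1 : σE 1 ≠ 1) (hE4 : σE 4 ≠ 4)
    (hZ0 : σZ 0 = 0) (hZ4 : σZ 4 = 4) (hZ1 : σZ 1 ≠ 1) (hZ2 : σZ 2 ≠ 2) (hZ3 : σZ 3 ≠ 3) : False := by
  have sB := slope_B g hg σB hB1 hB2 hB0 hB3 hB4
  have sC := slope_C g hg σC hC1 hC3 hC0 hC2 hC4
  have sE := slope_E g hg σE hE2 hE3 hE0 hE1 hE4
  have sZ := slope_Z g hg σZ hZ0 hZ4 hZ1 hZ2 hZ3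
  have hBC : θB ≤ θC := (theta_lt_of_isMax ok w g hB hC (by rw [sB, sC]; norm_num)).le
  have hBE : θB ≤ θE := (theta_lt_of_isMax ok w g hB hE (by rw [sB, sE]; norm_num)).le
  have hBZ : θB ≤ θZ := (theta_lt_of_isMax ok w g hB hZ (by rw [sB, sZ]; norm_num)).le
  have hCE : θC ≤ θE := (theta_lt_of_isMax ok w g hC hE (by rw [sC, sE]; norm_num)).le
  have hCZ : θC ≤ θZ := (theta_lt_of_isMax ok w g hC hZ (by rw [sC, sZ]; norm_num)).le
  have hEZ : θE ≤ θZ := (theta_lt_of_isMax ok w g hE hZ (by rw [sE, sZ]; norm_num)).le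
  rcases cases_Z σZ hZ0 hZ4 hZ1 hZ2 hZ3 with ⟨a, b, c, d⟩ | ⟨a, b, c, d⟩ | ⟨a, b, c, d⟩ | ⟨a, b, c, d⟩ | ⟨a, b, c, d⟩ | ⟨a, b, c, d⟩ | ⟨a, b, c, d⟩ | ⟨a, b, c, d⟩ | ⟨a, b, c, d⟩ | ⟨a, b, c, d⟩ | ⟨a, b, c, d⟩
  · exact caseZ0 ok w g hg hBC hBE hBZ hCE hCZ hEZ hB hC hE hZ hB1 hB2 hB0 hB3 hB4 hC1 hC3 hC0 hC2 hC4 hE2 hE3 hE0 hE1 hE4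
      (by intro i; fin_cases i <;> simp [hZ0, hZ4, a, b, c, d])
  · exact caseZ1 ok w g hg hBC hBE hBZ hCE hCZ hEZ hB hC hE hZ hB1 hB2 hB0 hB3 hB4 hC1 hC3 hC0 hC2 hC4 hE2 hE3 hE0 hE1 hE4
      (by intro i; fin_cases i <;> simp [hZ0, hZ4, a, b, c, d])
  · exact caseZ2 ok w g hg hBC hBE hBZ hCE hCZ hEZ hB hC hE hZ hB1 hB2 hB0 hB3 hB4 hC1 hC3 hC0 hC2 hC4 hE2 hE3 hE0 hE1 hE4
      (by intro i; fin_cases i <;> simp [hZ0, hZ4, a, b, c, d])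
  · exact caseZ3 ok w g hg hBC hBE hBZ hCE hCZ hEZ hB hC hE hZ hB1 hB2 hB0 hB3 hB4 hC1 hC3 hC0 hC2 hC4 hE2 hE3 hE0 hE1 hE4
      (by intro i; fin_cases i <;> simp [hZ0, hZ4, a, b, c, d])
  · exact caseZ4 ok w g hg hBC hBE hBZ hCE hCZ hEZ hB hC hE hZ hB1 hB2 hB0 hB3 hB4 hC1 hC3 hC0 hC2 hC4 hE2 hE3 hE0 hE1 hE4
      (by intro i; fin_cases i <;> simp [hZ0, hZ4, a, b, c, d])
  · exact caseZ5 ok w g hg hBC hBE hBZ hCE hCZ hEZ hB hC hE hZ hB1 hB2 hB0 hB3 hB4 hC1 hC3 hC0 hC2 hC4 hE2 hE3 hE0 hE1 hE4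
      (by intro i; fin_cases i <;> simp [hZ0, hZ4, a, b, c, d])
  · exact caseZ6 ok w g hg hBC hBE hBZ hCE hCZ hEZ hB hC hE hZ hB1 hB2 hB0 hB3 hB4 hC1 hC3 hC0 hC2 hC4 hE2 hE3 hE0 hE1 hE4
      (by intro i; fin_cases i <;> simp [hZ0, hZ4, a, b, c, d])
  · exact caseZ7 ok w g hg hBC hBE hBZ hCE hCZ hEZ hB hC hE hZ hB1 hB2 hB0 hB3 hB4 hC1 hC3 hC0 hC2 hC4 hE2 hE3 hE0 hE1 hE4
      (by intro i; fin_cases i <;> simp [hZ0, hZ4, a, b, c, d])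
  · exact caseZ8 ok w g hg hBC hBE hBZ hCE hCZ hEZ hB hC hE hZ hB1 hB2 hB0 hB3 hB4 hC1 hC3 hC0 hC2 hC4 hE2 hE3 hE0 hE1 hE4
      (by intro i; fin_cases i <;> simp [hZ0, hZ4, a, b, c, d])
  · exact caseZ9 ok w g hg hBC hBE hBZ hCE hCZ hEZ hB hC hE hZ hB1 hB2 hB0 hB3 hB4 hC1 hC3 hC0 hC2 hC4 hE2 hE3 hE0 hE1 hE4
      (by intro i; fin_cases i <;> simp [hZ0, hZ4, a, b, c, d])
  · exact caseZ10 ok w g hg hBC hBE hBZ hCE hCZ hEZ hB hC hE hZ hB1 hB2 hB0 hB3 hB4 hC1 hC3 hC0 hC2 hC4 hE2 hE3 hE0 hE1 hE4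
      (by intro i; fin_cases i <;> simp [hZ0, hZ4, a, b, c, d])

end CoreSix
end MarkedEdge
end Summit.ValiantsHypothesis.ValiantsHypothesis.Theorems.KPlusLogSqLaw
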